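import Mathlib.Analysis.Complex.ExponentialBounds
import Mathlib.Analysis.SpecialFunctions.Log.Base
import Mathlib.Data.Nat.Choose.Bounds
import Literature.Probability.LatticeModels.IntersectionClusteringSkeleton
import HarnessLib

/-!
# Numerics for independent sets in random lifts

Topic `Literature/Combinatorics/SimpleGraph`.  Pure real arithmetic closing the first-moment count
of `LiftIndependence.lean` (`sum_card_indepLifts_le`): for `d ≥ 8`, `1 ≤ m ≤ d/(4 log₂ d)`,
base order `w ≥ d`, fibre size `a ≥ 1` and any `t ≥ wa/m`,

  `C(wa, t) · exp(-(t² - 3at)/(2a)) ≤ 1/4`                  (`independence_numerics`).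

Steps: `C(wa,t) ≤ (e·wa/t)^t` (the tree's `choose_le_exp_mul_div_pow`) `≤ (e m)^t = exp(t(1 + log m))`; `(t² - 3at)/(2a) ≥
t(w/(2m) - 3/2)` and `w/(2m) ≥ d/(2m) ≥ 2 log₂ d`; `log m ≤ log d`; and the numerical fact
`7/2 + log d ≤ 2 log d / log 2` for `d ≥ 8` (`log 2 < 0.7`), whence the exponent is `≤ -t ≤ -2`.
Used for the random-graph input of Conneryd–Ghannane–Pang 2025, Theorem 6.1 (chromatic number
of the fooling graphs, Lemma 6.2 of the source).

## References

* [folklore] first-moment numerics.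
* [ConnerydGhannanePang2025] arXiv:2511.17272, Lemma 6.2 (the statement these numerics serve).
-/

namespace Literature.Combinatorics.SimpleGraph

open Real

/-- The numerical fact: `7/2 + log d ≤ 2 log d / log 2` for `d ≥ 8`. [folklore] -/
theorem seven_halves_add_log_le {d : ℕ} (hd : 8 ≤ d) :
    7 / 2 + Real.log d ≤ 2 * Real.log d / Real.log 2 := by
  have hl2 : 0 < Real.log 2 := Real.log_pos (by norm_num)
  have hl2' : Real.log 2 < 0.7 := Real.log_two_lt_d9.trans (by norm_num)
  have hd8 : 3 * Real.log 2 ≤ Real.log d := by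
    rw [← Real.log_rpow (by norm_num), show ((2 : ℝ) ^ (3 : ℝ)) = 8 by norm_num]
    exact Real.log_le_log (by norm_num) (by exact_mod_cast hd)
  rw [le_div_iff₀ hl2]
  -- `(7/2 + x) log 2 ≤ 2x` for `x ≥ 3 log 2`, `log 2 < 0.7`
  nlinarith

/-- **The independence numerics**: for `d ≥ 8`, `1 ≤ m ≤ d/(4 log₂ d)`, `w ≥ d`, `a ≥ 1` and
`t ≥ wa/m`: `C(wa, t) · exp(-(t² - 3at)/(2a)) ≤ 1/4`. [folklore] -/
theorem independence_numerics {d m w a t : ℕ} (hd : 8 ≤ d) (hm1 : 1 ≤ m)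
    (hm : (m : ℝ) ≤ d / (4 * Real.logb 2 d)) (hw : d ≤ w) (ha : 1 ≤ a)
    (ht : ((w * a : ℕ) : ℝ) / m ≤ t) :
    ((w * a).choose t : ℝ) * Real.exp (-((t : ℝ) ^ 2 - 3 * a * t) / (2 * a)) ≤ 1 / 4 := by
  have hm0 : (0 : ℝ) < m := by exact_mod_cast hm1
  have ha0 : (0 : ℝ) < a := by exact_mod_cast ha
  have hd0 : (0 : ℝ) < d := by exact_mod_cast (by omega : 0 < d)
  have hdw : (d : ℝ) ≤ w := by exact_mod_cast hw
  have hl2 : 0 < Real.log 2 := Real.log_pos (by norm_num)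
  -- `log₂ d ≥ 3`
  have hlog2d : (3 : ℝ) ≤ Real.logb 2 d := by
    rw [Real.le_logb_iff_rpow_le (by norm_num) hd0]
    norm_num
    exact_mod_cast hd
  have hlogb : Real.logb 2 d = Real.log d / Real.log 2 := (Real.log_div_log).symm
  have hL0 : 0 < Real.logb 2 d := by linarith
  -- from `m ≤ d/(4 log₂ d)`: `4 m log₂ d ≤ d`, `m ≤ d`
  have h4m : 4 * m * Real.logb 2 d ≤ d := by
    rw [le_div_iff₀ (by positivity)] at hm
    linarith
  have hmd : (m : ℝ) ≤ d := by nlinarith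
  -- `t ≥ wa/m ≥ 4 log₂ d ≥ 2`
  have hwa : ((w * a : ℕ) : ℝ) = w * a := by push_cast; ring
  have ht4 : (4 : ℝ) ≤ t := by
    have hwa1 : (d : ℝ) ≤ w * a :=
      hdw.trans (le_mul_of_one_le_right (by positivity) (by exact_mod_cast ha))
    have h1 : (w : ℝ) * a / m ≥ d / m := by
      rw [ge_iff_le, div_le_div_iff_of_pos_right hm0]
      exact hwa1
    have h2 : (d : ℝ) / m ≥ 4 * Real.logb 2 d := by
      rw [ge_iff_le, le_div_iff₀ hm0]; linarith
    rw [hwa] at ht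
    linarith
  have ht0 : (0 : ℝ) < t := by linarith
  have ht1 : 1 ≤ t := by exact_mod_cast (show (1 : ℝ) ≤ t by linarith)
  -- the binomial coefficient
  have hC : ((w * a).choose t : ℝ) ≤ Real.exp (t * (1 + Real.log m)) := by
    refine (Literature.Probability.LatticeModels.choose_le_exp_mul_div_pow ht1).trans ?_
    have hq : Real.exp 1 * ((w * a : ℕ) : ℝ) / t ≤ Real.exp 1 * m := by
      rw [mul_div_assoc]
      refine mul_le_mul_of_nonneg_left ?_ (Real.exp_pos 1).le
      rw [div_le_iff₀ ht0]
      rw [div_le_iff₀ hm0] at ht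
      linarith
    calc (Real.exp 1 * ((w * a : ℕ) : ℝ) / t) ^ t ≤ (Real.exp 1 * m) ^ t :=
          pow_le_pow_left₀ (by positivity) hq t
      _ = Real.exp (t * (1 + Real.log m)) := by
          rw [show Real.exp 1 * m = Real.exp (1 + Real.log m) by rw [Real.exp_add, Real.exp_log hm0],
            ← Real.exp_nat_mul]
  -- the exponent
  have hE : -((t : ℝ) ^ 2 - 3 * a * t) / (2 * a) ≤ -(t * ((w : ℝ) / (2 * m) - 3 / 2)) := by
    have h1 : (w : ℝ) * a / m ≤ t := by rwa [hwa] at ht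
    have h3 : (t : ℝ) * (w * a / m) ≤ t * t := mul_le_mul_of_nonneg_left h1 ht0.le
    have key : (t : ℝ) * ((w : ℝ) / (2 * m) - 3 / 2) * (2 * a) ≤ (t : ℝ) ^ 2 - 3 * a * t := by
      have : (t : ℝ) * ((w : ℝ) / (2 * m) - 3 / 2) * (2 * a) = t * (w * a / m) - 3 * a * t := by
        field_simp
      rw [this, sq]; linarith
    rw [div_le_iff₀ (by positivity), neg_mul]
    linarith
  -- `w/(2m) ≥ 2 log₂ d`
  have hW : 2 * Real.logb 2 d ≤ (w : ℝ) / (2 * m) := by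
    rw [le_div_iff₀ (by positivity)]; nlinarith
  have hnum := seven_halves_add_log_le hd
  have hlogm : Real.log m ≤ Real.log d := Real.log_le_log hm0 hmd
  -- assemble
  calc ((w * a).choose t : ℝ) * Real.exp (-((t : ℝ) ^ 2 - 3 * a * t) / (2 * a))
      ≤ Real.exp (t * (1 + Real.log m)) * Real.exp (-(t * ((w : ℝ) / (2 * m) - 3 / 2))) := by
        gcongr
    _ = Real.exp (t * (5 / 2 + Real.log m - (w : ℝ) / (2 * m))) := by rw [← Real.exp_add]; ring_nf
    _ ≤ Real.exp (-2) := by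
        rw [Real.exp_le_exp]
        have hcoef : 5 / 2 + Real.log m - (w : ℝ) / (2 * m) ≤ -1 := by
          rw [hlogb] at hW
          have hnum' : 7 / 2 + Real.log d ≤ 2 * (Real.log d / Real.log 2) := by
            rw [mul_div_assoc] at hnum; exact hnum
          linarith
        nlinarith
    _ ≤ 1 / 4 := by
        rw [← Real.exp_one_rpow, show (-2 : ℝ) = -(2 : ℝ) by ring, Real.rpow_neg (Real.exp_pos 1).le,
          one_div, inv_le_inv₀ (by positivity) (by norm_num)]
        have h := Real.exp_one_gt_d9
        have : (4 : ℝ) ≤ 2.7182818283 ^ (2 : ℝ) := by norm_num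
        exact this.trans (Real.rpow_le_rpow (by norm_num) h.le (by norm_num))

end Literature.Combinatorics.SimpleGraph
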